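import Mathlib
import Literature.NumberTheory.LFunctions.Zhang2022.Section2GammaFactor
import HarnessLib

/-!
# Zhang (2022), §2 (2.2): the functional equation `L(s,θ) = Z(s,θ)L(1−s,θ̄)` in the source's
# normalisation, from Mathlib's completed-`L`-function functional equation, kernel-checked

Topic `Literature/NumberTheory/LFunctions/Zhang2022` (Landau–Siegel autopsy tree; verdict-neutral).
Y. Zhang, *Discrete mean estimates and the Landau–Siegel zero*, arXiv:2211.02515v1 (2022) — **an
unrefereed manuscript, a claimed result under adjudication** (cell pub-zhang: audit + repair census
of arXiv:2211.02515; no claim about Landau–Siegel) — §2, p. 4: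

> In case `θ (mod k)` is a primitive character, the functional equation for `L(s,θ)` is
> `L(s,θ) = Z(s,θ)L(1−s,θ̄)`                                                              (2.2)
> where `Z(s,θ) = τ(θ)π^{s−1/2}k^{−s}Γ((1−s)/2)Γ(s/2)⁻¹` if `θ(−1) = 1`,
> `Z(s,θ) = −iτ(θ)π^{s−1/2}k^{−s}Γ((2−s)/2)Γ((1+s)/2)⁻¹` if `θ(−1) = −1`,
> `τ(θ)` is the Gauss sum […]

and §2, p. 5: "The functional equation (2.2) gives `M(s,ψ) = Y(s,ψ)⁻¹L(1−s,ψ̄)`" (with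
`M = YL`, `Y² = Z⁻¹`).

`Section2GammaFactor` defines `GammaFactor.Zfac θ s` by the two printed formulas and proves
(2.3)–(2.5) about it; this file certifies that this `Zfac` IS the factor of the functional equation
of Mathlib's Dirichlet `L`-function `DirichletCharacter.LFunction θ` (analytic continuation
included), i.e. PROVES (2.2):

* `GammaFactor.Zfac_eq_gammaFactor_div` — `Z(s,θ) = ε(θ)τ(θ)k^{−s}γ(θ̄,1−s)/γ(θ,s)`, `ε = 1`
  resp. `−i`, `γ` = Mathlib's `DirichletCharacter.gammaFactor` (`Γ_ℝ(s)` / `Γ_ℝ(s+1)`);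
* `GammaFactor.LFunction_eq_Zfac_mul` — **(2.2)**: for `θ` primitive mod `k ≠ 1` and `Im s ≠ 0`,
  `LFunction θ s = Zfac θ s * LFunction θ⁻¹ (1 − s)` (from Mathlib's
  `IsPrimitive.completedLFunction_one_sub`: `Λ(1−s,θ) = k^{s−½}ρ(θ)Λ(s,θ̄)` with root number
  `ρ(θ) = τ(θ)/(i^a k^{½})`, and `LFunction_eq_completed_div_gammaFactor`; the hypothesis
  `Im s ≠ 0` keeps the archimedean factors finite and non-zero, which is the range `t > 0` of the
  source; `k ≠ 1` excludes `ζ`);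
* `GammaFactor.sqrt_inv_Zfac_mul_LFunction` — the p. 5 consequence `yL(s,θ) = y⁻¹L(1−s,θ̄)` for
  any `y` with `y² = Z(s,θ)⁻¹`.

Nothing about Theorems 1–2 of the source is stated or implied; nothing here bears on the cell's
verdict on (8.24).

## References

* Y. Zhang, arXiv:2211.02515v1 (2022), §2 p. 4 (2.2); p. 5. [cite: Zhang2022LandauSiegel, §2 (2.2)]
* Mathlib, `Mathlib.NumberTheory.LSeries.DirichletContinuation`
  (`DirichletCharacter.IsPrimitive.completedLFunction_one_sub`, `rootNumber`, `gammaFactor`).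
-/

noncomputable section

open Complex Real

namespace Literature.NumberTheory.LFunctions.Zhang2022.GammaFactor

variable {k : ℕ} [NeZero k]

omit [NeZero k] in
/-- Mathlib's archimedean factor `γ(θ, s)` (`Γ_ℝ(s)` for even, `Γ_ℝ(s+1)` for odd `θ`,
`DirichletCharacter.gammaFactor`) does not vanish off the real axis. [folklore] -/
theorem gammaFactor_ne_zero_of_im_ne_zero (θ : DirichletCharacter ℂ k) {s : ℂ} (hs : s.im ≠ 0) :
    DirichletCharacter.gammaFactor θ s ≠ 0 := by
  have hΓ : ∀ z : ℂ, z.im ≠ 0 → Gammaℝ z ≠ 0 := by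
    intro z hz
    rw [Ne, Gammaℝ_eq_zero_iff]
    rintro ⟨n, hn⟩
    apply hz
    rw [hn]
    simp
  unfold DirichletCharacter.gammaFactor
  split_ifs
  · exact hΓ s hs
  · exact hΓ (s + 1) (by simpa using hs)

open scoped Classical in
/-- `Z(s,θ)` in terms of Mathlib's archimedean factors:
`Z(s,θ) = ε(θ)·τ(θ)·k^{−s}·γ(θ̄, 1−s)/γ(θ, s)` with `ε = 1` (even `θ`) resp. `−i` (odd `θ`), where
`γ(θ,s) = Γ_ℝ(s)` resp. `Γ_ℝ(s+1)` (`DirichletCharacter.gammaFactor`; `θ̄ = θ⁻¹` has the parity of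
`θ`). [cite: Zhang2022LandauSiegel, §2 (2.2)] -/
theorem Zfac_eq_gammaFactor_div (θ : DirichletCharacter ℂ k) (s : ℂ) :
    Zfac θ s = (if θ.Even then 1 else -I) * tau θ * (k : ℂ) ^ (-s)
      * (DirichletCharacter.gammaFactor θ⁻¹ (1 - s) / DirichletCharacter.gammaFactor θ s) := by
  have hπ : (π : ℂ) ≠ 0 := ofReal_ne_zero.mpr Real.pi_ne_zero
  -- `θ̄(−1) = θ(−1)`, so `θ̄` is even iff `θ` is
  have hinv : θ⁻¹ (-1) = θ (-1) := by
    rw [MulChar.inv_apply_eq_inv']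
    refine inv_eq_of_mul_eq_one_left ?_
    rw [← map_mul, neg_one_mul, neg_neg, map_one]
  have heven : θ⁻¹.Even ↔ θ.Even := by
    rw [DirichletCharacter.Even, DirichletCharacter.Even, hinv]
  by_cases he : θ.Even
  · have he' : θ⁻¹.Even := heven.mpr he
    rw [Zfac, if_pos he, if_pos he, he'.gammaFactor_def, he.gammaFactor_def, Gammaℝ_def, Gammaℝ_def,
      show (π : ℂ) ^ (s - 1 / 2) = (π : ℂ) ^ (-(1 - s) / 2) * ((π : ℂ) ^ (-s / 2))⁻¹ by
        rw [← div_eq_mul_inv, ← cpow_sub _ _ hπ]; congr 1; ring]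
    simp only [div_eq_mul_inv, mul_inv]
    ring
  · have he' : ¬ θ⁻¹.Even := fun h => he (heven.mp h)
    unfold DirichletCharacter.gammaFactor
    rw [Zfac, if_neg he, if_neg he, if_neg he', if_neg he, Gammaℝ_def, Gammaℝ_def,
      show (1 : ℂ) - s + 1 = 2 - s by ring,
      show (π : ℂ) ^ (s - 1 / 2) = (π : ℂ) ^ (-(2 - s) / 2) * ((π : ℂ) ^ (-(s + 1) / 2))⁻¹ by
        rw [← div_eq_mul_inv, ← cpow_sub _ _ hπ]; congr 1; ring,
      show ((1 : ℂ) + s) / 2 = (s + 1) / 2 by ring]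
    simp only [div_eq_mul_inv, mul_inv]
    ring

open scoped Classical in
/-- **The functional equation (2.2) in the source's normalisation** ("In case `θ (mod k)` is a
primitive character, the functional equation for `L(s,θ)` is `L(s,θ) = Z(s,θ)L(1−s,θ̄)` (2.2)"):
for a primitive `θ` mod `k ≠ 1` and `s` off the real axis, `L(s,θ) = Z(s,θ)·L(1−s,θ̄)` with the
tree's `Zfac` and Mathlib's `DirichletCharacter.LFunction` — derived from Mathlib's
`IsPrimitive.completedLFunction_one_sub` (`Λ(1−s,θ) = k^{s−½}ρ(θ)Λ(s,θ̄)`, root number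
`ρ(θ) = τ(θ)/(i^a k^{½})`) and `LFunction_eq_completed_div_gammaFactor`. In particular the
tree's `Zfac` (the printed even/odd `Γ`-quotients, with the factor `−i` for odd `θ`) IS the
`Z(s,θ)` of (2.2). [cite: Zhang2022LandauSiegel, §2 (2.2)] -/
theorem LFunction_eq_Zfac_mul {θ : DirichletCharacter ℂ k} (hθ : θ.IsPrimitive) (hk : k ≠ 1)
    {s : ℂ} (hs : s.im ≠ 0) :
    θ.LFunction s = Zfac θ s * θ⁻¹.LFunction (1 - s) := by
  have hk0 : (k : ℂ) ≠ 0 := Nat.cast_ne_zero.mpr (NeZero.ne k)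
  have hs' : (1 - s).im ≠ 0 := by simpa using hs
  have h1 := DirichletCharacter.LFunction_eq_completed_div_gammaFactor θ s (Or.inr hk)
  have h2 := DirichletCharacter.IsPrimitive.completedLFunction_one_sub hθ (1 - s)
  rw [sub_sub_cancel] at h2
  have h3 := DirichletCharacter.LFunction_eq_completed_div_gammaFactor θ⁻¹ (1 - s) (Or.inr hk)
  have hγ2 := gammaFactor_ne_zero_of_im_ne_zero θ⁻¹ hs'
  have h3' : DirichletCharacter.completedLFunction θ⁻¹ (1 - s)
      = θ⁻¹.LFunction (1 - s) * DirichletCharacter.gammaFactor θ⁻¹ (1 - s) := by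
    rw [h3, div_mul_cancel₀ _ hγ2]
  have hρ : (k : ℂ) ^ ((1 : ℂ) - s - 1 / 2) * DirichletCharacter.rootNumber θ
      = (if θ.Even then 1 else -I) * tau θ * (k : ℂ) ^ (-s) := by
    unfold DirichletCharacter.rootNumber
    have hkpow : (k : ℂ) ^ ((1 : ℂ) - s - 1 / 2) = (k : ℂ) ^ (-s) * (k : ℂ) ^ ((1 : ℂ) / 2) := by
      rw [← cpow_add _ _ hk0]; congr 1; ring
    have hkh : (k : ℂ) ^ ((1 : ℂ) / 2) ≠ 0 := by
      rw [Ne, cpow_eq_zero_iff, not_and_or]; exact Or.inl hk0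
    rw [hkpow, tau]
    split_ifs with he
    · rw [pow_zero, div_one]
      field_simp
    · rw [pow_one]
      field_simp
      rw [I_sq]
      ring
  calc θ.LFunction s
      = DirichletCharacter.completedLFunction θ s / DirichletCharacter.gammaFactor θ s := h1
    _ = ((k : ℂ) ^ ((1 : ℂ) - s - 1 / 2) * DirichletCharacter.rootNumber θ)
          * (DirichletCharacter.gammaFactor θ⁻¹ (1 - s) / DirichletCharacter.gammaFactor θ s)
          * θ⁻¹.LFunction (1 - s) := by
        rw [h2, h3']
        field_simp
    _ = Zfac θ s * θ⁻¹.LFunction (1 - s) := by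
        rw [hρ, Zfac_eq_gammaFactor_div]

/-- "The functional equation (2.2) gives `M(s,ψ) = Y(s,ψ)⁻¹L(1−s,ψ̄)`" (§2 p. 5), where
`M(s,ψ) = Y(s,ψ)L(s,ψ)` and `Y(s,ψ)² = Z(s,ψ)⁻¹`: pointwise, for any `y` with `y² = Z(s,θ)⁻¹`,
`y·L(s,θ) = y⁻¹·L(1−s,θ̄)`. [cite: Zhang2022LandauSiegel, §2 p. 5] -/
theorem sqrt_inv_Zfac_mul_LFunction {θ : DirichletCharacter ℂ k} (hθ : θ.IsPrimitive) (hk : k ≠ 1)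
    {s : ℂ} (hs : s.im ≠ 0) {y : ℂ} (hy : y ^ 2 = (Zfac θ s)⁻¹) :
    y * θ.LFunction s = y⁻¹ * θ⁻¹.LFunction (1 - s) := by
  rw [LFunction_eq_Zfac_mul hθ hk hs]
  rcases eq_or_ne y 0 with rfl | hy0
  · simp
  · have hZ : Zfac θ s = (y ^ 2)⁻¹ := by rw [hy, inv_inv]
    rw [hZ]
    field_simp

end Literature.NumberTheory.LFunctions.Zhang2022.GammaFactor
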